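import Summits.PneNP.PneNP.Cruxes.CollapseMakesPermanentEasy.Disproof
import Literature.Computability.Complexity.ParityQuantifier
import Literature.Computability.Complexity.PolyHierarchy
import Literature.Computability.Complexity.ProbabilisticClasses
import Literature.Computability.Complexity.Oracle

/-!
# Strategist r1 on crux `K = CollapseMakesPermanentEasy` (item stmt-PneNP-16142) — typed forms
behind `STRATEGY-CENSUS-r1.md` (second, independent census; r-lineage).

Everything here ELABORATES WITHOUT `sorry`; nothing here is a line or a stub (a no-strategy census may not
register stubs). Sections mirror the census headings:

* §D  Decomposition — D1 (parity rung) typed with its glue PROVED (`crux_of_parityRung`), and the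
       observation that piece 2 is a CONSEQUENCE of `K` (`parityLifts_of_crux`) while both pieces are
       consequences of the summit (`parityRung_of_summit`): the split is honest in shape and engine-less in
       content (census §Decomposition).
* §S  Strengthen — S5 `FiniteCollapseCapturesPP` ("a finite collapse of PH drags PP into PH") and its
       reduction to the class form of `K` (`classK_of_S5`, textbook facts as named hypotheses).
* §R  Transfer / rung — `FineRung p q θ`, the relativizing guess-and-split rung in the
       (SAT-exponent, running-time) plane (census §Transfer (d)); a `def` only: its proof is a padding
       argument over `NTIME`/`DTIME` that the tree's machine layer does not yet support, and it is NOT a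
       stub of any line (it does not compose to `K`).
* §N  Negation — `TypedShape O`, the per-language relativization of `K` AS TYPED, and
       `W_of_typedShape_fails`: exhibiting ANY oracle against the typed shape already proves the sibling
       crux `W` (census §Negation (N1)).
-/

set_option linter.dupNamespace false
set_option linter.unusedVariables false

namespace Summit.PneNP.PneNP.Cruxes.CollapseMakesPermanentEasy.StrategistR1

open Literature.Computability.Complexity
open Summit.PneNP.PneNP.Theses.PermanentDescent
open Summit.PneNP.PneNP.Cruxes.CollapseMakesPermanentEasy.Disproof

/-! ## §D Decomposition D1 — the parity rung -/

/-- D1, piece 1 ("Algorithmica kills parity counting"): `NP ⊆ P → ⊕P ⊆ P`.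
Open; relativized-false (Ko 1989: `L_B ∈ ⊕P^B ∖ P^B` with `P^B = NP^B`); TRUE in the characteristic-2
affine world of the disprover's Theorem A′ (there `⊕P^𝒜 ⊆ P^𝒜`), so the affine barrier does NOT bite it. -/
def CollapseKillsParity : Prop := Collapse → ParityP ⊆ Classes.P

/-- D1, piece 2 ("parity + search ⇒ exact permanent"): `NP ⊆ P → ⊕P ⊆ P → PermBits ∈ P`.
Open; a consequence of `K` (`parityLifts_of_crux`); FALSE in the characteristic-2 affine world
(`P = NP = ⊕P`, `PP ⊄ P` there), so the affine barrier localises to THIS piece. -/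
def ParityLiftsPermanent : Prop := Collapse → ParityP ⊆ Classes.P → PermBits ∈ Classes.P

/-- Glue of D1 (modus ponens): the two pieces give the crux BY NAME. -/
theorem crux_of_parityRung (a : CollapseKillsParity) (b : ParityLiftsPermanent) :
    CollapseMakesPermanentEasy :=
  fun h => b h (a h)

/-- Piece 2 is implied by the crux (drop the parity hypothesis). -/
theorem parityLifts_of_crux (k : CollapseMakesPermanentEasy) : ParityLiftsPermanent :=
  fun h _ => k h

/-- Hence, GIVEN piece 1, the crux and piece 2 are equivalent: the split moves no difficulty unless
piece 1 is proved first. -/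
theorem crux_iff_piece2_of_piece1 (a : CollapseKillsParity) :
    CollapseMakesPermanentEasy ↔ ParityLiftsPermanent :=
  ⟨parityLifts_of_crux, fun b => crux_of_parityRung a b⟩

/-- Both pieces are consequences of the summit (vacuously, like `K`): the `S → C` probes close, the
`C → S` probes do not (neither piece mentions `W`). -/
theorem parityRung_of_summit (hs : _root_.PneNP) : CollapseKillsParity ∧ ParityLiftsPermanent := by
  have hnc : ¬ Collapse := fun hc => (collapse_iff_not_summit.1 hc) hs
  exact ⟨fun hc => absurd hc hnc, fun hc => absurd hc hnc⟩

/-! ## §S Strengthen S5 — finite PH-collapse captures PP -/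

/-- S5 (`K_PH`): "if PH collapses to a finite level then PP ⊆ PH". Stronger than the class form of `K`
(`classK_of_S5`); relativized-false by the SAME Ko world (`PH^B = P^B`, `PP^B ⊄ P^B`); the converse
direction `PP ⊆ PH → PH collapses` is Toda's theorem. No engine: the added generality (level `k` instead
of `0`) removes the SAT algorithm, the only handle `K` had. -/
def FiniteCollapseCapturesPP : Prop := (∃ k : ℕ, PH ⊆ SigmaP k) → PP ⊆ PH

/-- S5 ⇒ class form of `K`, given the textbook collapse `NP ⊆ P → PH ⊆ P` as a named hypothesis
(Arora–Barak Thm 5.4; in-tree analogues exist for BPP: `PH_subset_BPP_of_NP_subset_BPP`). -/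
theorem classK_of_S5 (hPHc : Nondeterministic.NP ⊆ Classes.P → PH ⊆ Classes.P)
    (s5 : FiniteCollapseCapturesPP) :
    Nondeterministic.NP ⊆ Classes.P → PP ⊆ Classes.P := by
  intro hc
  have hPH : PH ⊆ Classes.P := hPHc hc
  have hfin : ∃ k : ℕ, PH ⊆ SigmaP k := ⟨0, fun L hL => by
    have := hPH hL
    simpa [SigmaP, sigmaP] using this⟩
  exact fun L hL => hPH (s5 hfin hL)

/-! ## §R Transfer (d) — the relativizing fine-exponent rung (statement only) -/

/-- `FineRung p q θ`: "SAT-exponent `c = p/q` ⇒ the permanent's bit-graph in time `2^{θ√m}`"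
(`m` = input length `≈ 2n² + O(log)`, so `2^{θ√m} ≈ 2^{θ√2·n}`), in class form
`NTIME(n) ⊆ DTIME(n^{p/q}) → PermBits ∈ DTIME(2^{⌈θ√m⌉})`.
CLAIM (census §Transfer (d), a padding argument, relativizing): provable whenever
`θ√2 > h(c) := min_{k ≥ 2} c^{2k-2}/k`, in particular non-trivial (`θ√2 < 1`) iff `c < √2`;
`K` implies every `FineRung p q θ` with `θ > 0`. NOT a stub: no conjunction of fine rungs reaches `K`
(for each fixed `c > 1`, `h(c) > 0`). Recorded so that a tenure planner can cite a typed BC5-style rung. -/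
def FineRung (p q : ℕ) (θ : ℝ) : Prop :=
  NTIME (fun n => n) ⊆ DTIME (fun n => ⌊((n : ℝ) ^ ((p : ℝ) / (q : ℝ)))⌋₊) →
    PermBits ∈ DTIME (fun m => 2 ^ ⌈θ * Real.sqrt (m : ℝ)⌉₊)

/-! ## §N Negation (N1) — the typed shape cannot be relativized-refuted short of `W` -/

/-- The per-language relativization of `K` AS TYPED: the conclusion keeps the FIXED language `PermBits`
(only the machines get the oracle). Compare `Disproof.ClassShape`, where the conclusion is `PP^O ⊆ P^O`. -/
def TypedShape (O : Oracle) : Prop := NPRel O ⊆ PRel O → PermBits ∈ PRel O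

/-- (N1) Any oracle witnessing the failure of the typed shape is already a proof of the sibling crux
`W = PermanentNotInP` (because `P ⊆ P^O`): the typed `K` admits no relativized counter-world short of an
unconditional lower bound for the permanent, although its class shape does (`not_relativizes_classShape_of_koWorld`).
[`P_subset_PRel` is the tree's named fact `P ⊆ P^O`, Baker–Gill–Solovay 1975 §1.] -/
theorem W_of_typedShape_fails (hP : P_subset_PRel) (h : ∃ O : Oracle, ¬ TypedShape O) :
    PermanentNotInP := by
  obtain ⟨O, hO⟩ := h
  have hnot : PermBits ∉ PRel O := fun hmem => hO (fun _ => hmem)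
  exact (W_iff).2 (fun hPmem => hnot (hP O hPmem))

/-- Conversely, `W` makes the typed shape fail at every oracle that collapses `NP^O` into `P^O` but keeps
`PermBits` out of `P^O` — e.g. none we can name: for `O = ∅` this is `¬K` itself (`not_crux_iff`). The
typed shape at the empty oracle IS the crux, given `P^∅ = P`, `NP^∅ = NP` as named hypotheses. -/
theorem typedShape_empty_iff (O₀ : Oracle) (hP : PRel O₀ = Classes.P) (hNP : NPRel O₀ = Nondeterministic.NP) :
    TypedShape O₀ ↔ CollapseMakesPermanentEasy := by
  unfold TypedShape
  rw [hP, hNP]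
  exact Iff.rfl

end Summit.PneNP.PneNP.Cruxes.CollapseMakesPermanentEasy.StrategistR1
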